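import Mathlib
import HarnessLib

/-!
# `NoHeavyLowerTail` (stmt-CriticalPhenomena-4575) — an Abel-summation positivity lemma on a finite poset

Support file, seat `prim-l12-p5` (gen 17), `--supports stmt-CriticalPhenomena-4575`.  Standard axioms, no sorries, no definitions, no named facts.
The "layer-cake" step of the free-slot region reduction (memo FROM-prim-l12-p5-g17-FREE-SLOT-REGION-REDUCTION §1(iv)): on a finite partial order, if
`P ≥ 0`, `0 ≤ v`, `v` vanishes where `P` does, the ratios `v/P` are monotone in the cross-multiplied sense `v n · P n' ≤ v n' · P n` (`n ≤ n'`), and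
`Σ_{n∈U} z n · P n ≥ 0` for every up-closed `U`, then `Σ_n z n · v n ≥ 0` (`SahiFreeSlot.sum_mul_nonneg_of_upperSets`).  Proof: induction on the
support of `v`, peeling `θ·P·1_U` with `θ` the least ratio and `U` the up-closure of the support. [this work; folklore (Abel summation / layer cake)]
-/

namespace Summit.CriticalPhenomena.PercolationContinuityZ3.Theorems

namespace SahiFreeSlot

open Finset

variable {N : Type*} [Fintype N] [DecidableEq N] [PartialOrder N]

/-- **Abel-summation positivity on a finite poset.**  `z P v : N → ℝ`, `P ≥ 0`, `v ≥ 0`, `P n = 0 → v n = 0`, monotone ratios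
`v n · P n' ≤ v n' · P n` for `n ≤ n'`, and `0 ≤ Σ_{n∈U} z n · P n` for every up-closed finite set `U`; then `0 ≤ Σ_n z n · v n`.
[this work; folklore (Abel summation)] -/
theorem sum_mul_nonneg_of_upperSets (z P v : N → ℝ) (hP : ∀ n, 0 ≤ P n) (hv : ∀ n, 0 ≤ v n)
    (hvP : ∀ n, P n = 0 → v n = 0) (hmono : ∀ n n', n ≤ n' → v n * P n' ≤ v n' * P n)
    (hU : ∀ U : Finset N, (∀ n ∈ U, ∀ n', n ≤ n' → n' ∈ U) → 0 ≤ ∑ n ∈ U, z n * P n) :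
    0 ≤ ∑ n, z n * v n := by
  classical
  -- strong induction on the size of the support of `v`
  suffices H : ∀ k : ℕ, ∀ w : N → ℝ, (univ.filter fun n => 0 < w n).card = k → (∀ n, 0 ≤ w n) → (∀ n, P n = 0 → w n = 0) →
      (∀ n n', n ≤ n' → w n * P n' ≤ w n' * P n) → 0 ≤ ∑ n, z n * w n from
    H _ v rfl hv hvP hmono
  intro k
  induction k using Nat.strong_induction_on with
  | _ k ih =>
    intro w hk hw hwP hwmono
    set S : Finset N := univ.filter fun n => 0 < w n with hS
    by_cases hSe : S = ∅
    · -- empty support: `w = 0`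
      have hw0 : ∀ n, w n = 0 := by
        intro n
        have hn : n ∉ S := by rw [hSe]; exact notMem_empty n
        rw [hS, mem_filter] at hn
        push Not at hn
        exact le_antisymm (hn (mem_univ n)) (hw n)
      simp [hw0]
    · obtain ⟨n₀, hn₀S, hmin⟩ := exists_min_image S (fun n => w n / P n) (nonempty_iff_ne_empty.2 hSe)
      -- on the support, `P > 0`
      have hPpos : ∀ n ∈ S, 0 < P n := by
        intro n hn
        rw [hS, mem_filter] at hn
        rcases (hP n).lt_or_eq with h | h
        · exact h
        · exact absurd (hwP n h.symm) (ne_of_gt hn.2)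
      have hwS : ∀ n ∈ S, 0 < w n := fun n hn => by rw [hS, mem_filter] at hn; exact hn.2
      have hwnotS : ∀ n, n ∉ S → w n = 0 := by
        intro n hn
        rw [hS, mem_filter] at hn
        push Not at hn
        exact le_antisymm (hn (mem_univ n)) (hw n)
      set θ : ℝ := w n₀ / P n₀ with hθ
      have hθpos : 0 < θ := div_pos (hwS n₀ hn₀S) (hPpos n₀ hn₀S)
      -- the up-closure of the support
      set U : Finset N := univ.filter fun n' => ∃ n ∈ S, n ≤ n' with hUdef
      have hSU : ∀ n ∈ S, n ∈ U := fun n hn => by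
        rw [hUdef, mem_filter]; exact ⟨mem_univ n, n, hn, le_rfl⟩
      have hUup : ∀ n ∈ U, ∀ n', n ≤ n' → n' ∈ U := by
        intro n hn n' hnn'
        rw [hUdef, mem_filter] at hn ⊢
        obtain ⟨m, hm, hmn⟩ := hn.2
        exact ⟨mem_univ n', m, hm, hmn.trans hnn'⟩
      -- nodes of `U` off the support carry no mass
      have hUoff : ∀ n' ∈ U, n' ∉ S → P n' = 0 := by
        intro n' hn' hn'S
        rw [hUdef, mem_filter] at hn'
        obtain ⟨n, hn, hnn'⟩ := hn'.2
        have h1 := hwmono n n' hnn'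
        rw [hwnotS n' hn'S, zero_mul] at h1
        -- `w n * P n' ≤ 0` with `w n > 0` ⇒ `P n' ≤ 0`
        have h2 : P n' ≤ 0 := by
          by_contra hcon
          push Not at hcon
          exact absurd h1 (not_le.2 (mul_pos (hwS n hn) hcon))
        exact le_antisymm h2 (hP n')
      -- `θ · P ≤ w` on `U`
      have hθU : ∀ n' ∈ U, θ * P n' ≤ w n' := by
        intro n' hn'
        by_cases hn'S : n' ∈ S
        · have hle : θ ≤ w n' / P n' := hmin n' hn'S
          have := mul_le_mul_of_nonneg_right hle (hP n')
          rwa [div_mul_cancel₀ _ (ne_of_gt (hPpos n' hn'S))] at this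
        · rw [hUoff n' hn' hn'S, mul_zero]; exact hw n'
      -- the peeled function
      set w' : N → ℝ := fun n => w n - θ * P n * (if n ∈ U then 1 else 0) with hw'
      have hw'le : ∀ n, w' n ≤ w n := fun n => by
        simp only [hw']
        split_ifs
        · nlinarith [hP n, hθpos.le]
        · simp
      have hw'nn : ∀ n, 0 ≤ w' n := fun n => by
        simp only [hw']
        split_ifs with h
        · rw [mul_one]; linarith [hθU n h]
        · rw [mul_zero, sub_zero]; exact hw n
      have hw'P : ∀ n, P n = 0 → w' n = 0 := fun n h => by
        simp only [hw', h, hwP n h, mul_zero, zero_mul, sub_zero]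
      have hw'mono : ∀ n n', n ≤ n' → w' n * P n' ≤ w' n' * P n := by
        intro n n' hnn'
        simp only [hw']
        by_cases hn : n ∈ U
        · have hn' : n' ∈ U := hUup n hn n' hnn'
          simp only [hn, hn', if_true, mul_one]
          nlinarith [hwmono n n' hnn']
        · by_cases hn' : n' ∈ U
          · simp only [hn, hn', if_true, if_false, mul_one, mul_zero, sub_zero]
            have hnS : n ∉ S := fun h => hn (hSU n h)
            rw [hwnotS n hnS, zero_mul]
            exact mul_nonneg (by linarith [hθU n' hn']) (hP n)
          · simp only [hn, hn', if_false, mul_zero, sub_zero]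
            exact hwmono n n' hnn'
      -- the support shrinks: `w' n₀ = 0`
      have hw'n₀ : w' n₀ = 0 := by
        simp only [hw', hSU n₀ hn₀S, if_true, mul_one, hθ]
        rw [div_mul_cancel₀ _ (ne_of_gt (hPpos n₀ hn₀S)), sub_self]
      have hcard : (univ.filter fun n => 0 < w' n).card < k := by
        rw [← hk]
        refine card_lt_card ⟨fun n hn => ?_, fun hsub => ?_⟩
        · rw [mem_filter] at hn ⊢
          exact ⟨hn.1, lt_of_lt_of_le hn.2 (hw'le n)⟩
        · have : n₀ ∈ univ.filter fun n => 0 < w' n := hsub hn₀S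
          rw [mem_filter, hw'n₀] at this
          exact lt_irrefl _ this.2
      have IH := ih _ hcard w' rfl hw'nn hw'P hw'mono
      -- `Σ z w = Σ z w' + θ Σ_{U} z P`
      have hsplit : ∑ n, z n * w n = ∑ n, z n * w' n + θ * ∑ n ∈ U, z n * P n := by
        rw [mul_sum, ← sum_filter_add_sum_filter_not univ (fun n => n ∈ U) (fun n => z n * w' n)]
        rw [← sum_filter_add_sum_filter_not univ (fun n => n ∈ U) (fun n => z n * w n)]
        have hUeq : univ.filter (fun n => n ∈ U) = U := by ext n; simp
        rw [hUeq]
        have h1 : ∑ n ∈ U, z n * w n = ∑ n ∈ U, z n * w' n + ∑ n ∈ U, θ * (z n * P n) := by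
          rw [← sum_add_distrib]
          refine sum_congr rfl fun n hn => ?_
          simp only [hw', hn, if_true, mul_one]; ring
        have h2 : ∑ n ∈ univ.filter (fun n => n ∉ U), z n * w n = ∑ n ∈ univ.filter (fun n => n ∉ U), z n * w' n := by
          refine sum_congr rfl fun n hn => ?_
          rw [mem_filter] at hn
          simp only [hw', hn.2, if_false, mul_zero, sub_zero]
        rw [h1, h2]; ring
      rw [hsplit]
      exact add_nonneg IH (mul_nonneg hθpos.le (hU U hUup))

end SahiFreeSlot

end Summit.CriticalPhenomena.PercolationContinuityZ3.Theorems
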